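import Literature.AlgebraicGeometry.HodgeTheory.ProjectiveGlobalSectionsLowerBound
import Literature.AlgebraicGeometry.HodgeTheory.ProjectiveGrothendieckVanishing
import HarnessLib

/-!
# A zero-dimensional scheme of length `N` imposes at most `N` conditions on forms of every degree

For a closed subscheme `Z ⊆ ℙ^r` with CONSTANT Hilbert polynomial `P_Z = N` (a zero-dimensional scheme
of length `N`, or `Z = ∅` when `N = 0`), `h⁰(𝒪_Z(d)) = N` for every `d` (no higher cohomology,
Grothendieck; Hartshorne III Ex. 5.2, I Thm. 7.5) and the image of `S_d → Γ(𝒪_Z(d))` has kernel the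
saturated ideal in degree `d` (II Ex. 5.10). Hence the number `dim S_d - dim Ī_d` of conditions that
`Z` imposes on forms of degree `d` is at most `N`; for `d = 1`: a zero-dimensional scheme spanning
`ℙ^r` (`Ī_1 = 0`) has length `≥ r + 1`. In the tree's Čech language (`ProjectiveGlobalSectionsLowerBound`
for the embedding `(F_e)_d ⧸ K̄_d ↪ H⁰(Č_d(F_e ⧸ K))`, `ProjectiveGrothendieckVanishing` for
`h⁰(Č_d(F_e ⧸ K)) = Q` when `deg Q = 0`; `k` an infinite field, `r ≥ 1`, `K` graded):

* **`LaurentCech.finrank_le_eval_add_finrank_sat_of_natDegree_eq_zero`** —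
  `dim (F_e)_d ≤ Q + dim K̄_d` for every `d`;
* `LaurentCech.choose_le_length_add_finrank_sat` — for `Z = V(I) ⊆ ℙ^r` of constant Hilbert
  polynomial `N` and `d ≥ 0`: `C(d + r, r) ≤ N + dim Ī_d`;
* `LaurentCech.succ_le_length_add_finrank_sat_one` — `r + 1 ≤ N + dim Ī_1`
  (a zero-dimensional scheme not contained in a hyperplane has length `≥ r + 1`).

## References

* [Hartshorne1977] R. Hartshorne, *Algebraic Geometry*, GTM 52, Springer 1977, I Thm. 7.5 (p. 51),
  II Ex. 5.10 (p. 125), III Ex. 5.2 (p. 230).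
* [Eisenbud2005] D. Eisenbud, *The Geometry of Syzygies*, GTM 229, Springer 2005, §3A / Exercise 2.9
  (p. 68): "points impose independent conditions on forms of degree `d`".
-/

noncomputable section

open CategoryTheory CategoryTheory.Limits Polynomial

universe u

namespace Literature.Algebra.Homology

namespace LaurentCech

open OrderedCech TopCohomology

variable {k : Type u} [Field k] [Infinite k] {r : ℕ} {J : Type} [Fintype J] (e : J → ℤ)

/-- **`dim (F_e)_d ≤ Q + dim K̄_d` for every `d`** when the `χ`-polynomial `Q` of `M = F_e ⧸ K` is
constant (`deg Q = 0`; `K` graded, `k` infinite, `r ≥ 1`): `(F_e)_d ⧸ K̄_d` embeds into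
`H⁰(Č_d(M))`, of dimension `Q` for all `d`. [cite: Hartshorne1977, II Ex. 5.10 (p. 125)]
[cite: Hartshorne1977, III Ex. 5.2 (p. 230)] -/
theorem finrank_le_eval_add_finrank_sat_of_natDegree_eq_zero (hr : 1 ≤ r)
    {K : Submodule (P k r) (J → P k r)} (hK : IsGraded e K) {Q : ℚ[X]}
    (hQ : ∀ n : ℤ, ((∑ q ∈ Finset.range (r + 1), (-1 : ℤ) ^ q *
      (Module.finrank k ((quot e K n).homology q) : ℤ) : ℤ) : ℚ) = Q.eval (n : ℚ))
    (hQ0 : Q.natDegree = 0) (d : ℤ) :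
    (Module.finrank k (∀ j, (Ldeg k r (d - e j)).comap (toL k r).toLinearMap) : ℚ) ≤
      Q.eval (d : ℚ) + Module.finrank k (degPiece e (sat K) d) := by
  rw [← finrank_homology_quot_zero_eq_eval_of_natDegree_eq_zero e hr hK hQ hQ0 d]
  exact_mod_cast finrank_le_finrank_homology_quot_zero_add e hr hK d

/-- **A subscheme `Z = V(I) ⊆ ℙ^r_k` of constant Hilbert polynomial `N` imposes at most `N` conditions
on forms of degree `d`**: `C(d + r, r) ≤ N + dim Ī_d` for every `d ≥ 0` (`I ⊆ S` graded, `k`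
infinite, `r ≥ 1`). [cite: Hartshorne1977, II Ex. 5.10 (p. 125)] [cite: Hartshorne1977, I Thm. 7.5 (p. 51)] -/
theorem choose_le_length_add_finrank_sat (hr : 1 ≤ r) {I : Submodule (P k r) (Unit → P k r)}
    (hI : IsGraded (fun _ : Unit => (0 : ℤ)) I) {N : ℕ}
    (hQ : ∀ n : ℤ, ((∑ q ∈ Finset.range (r + 1), (-1 : ℤ) ^ q *
      (Module.finrank k ((quot (fun _ : Unit => (0 : ℤ)) I n).homology q) : ℤ) : ℤ) : ℚ) =
        (C (N : ℚ)).eval (n : ℚ))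
    {d : ℤ} (hd : 0 ≤ d) :
    (d.toNat + r).choose r ≤ N + Module.finrank k (degPiece (fun _ : Unit => (0 : ℤ)) (sat I) d) := by
  haveI : ∀ _ : Unit, Module.Finite k ((Ldeg k r (d - (fun _ : Unit => (0 : ℤ)) ())).comap
      (toL k r).toLinearMap) := fun _ => moduleFinite_comap_toL_Ldeg _
  have hF : Module.finrank k (∀ _ : Unit, (Ldeg k r (d - (fun _ : Unit => (0 : ℤ)) ())).comap
      (toL k r).toLinearMap) = (d.toNat + r).choose r := by
    rw [Module.finrank_pi_fintype, Fintype.sum_unique]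
    change Module.finrank k ((Ldeg k r (d - 0)).comap (toL k r).toLinearMap) = _
    rw [sub_zero, finrank_comap_toL_Ldeg, if_pos hd]
  have h := finrank_le_eval_add_finrank_sat_of_natDegree_eq_zero (fun _ : Unit => (0 : ℤ)) hr hI hQ
    (natDegree_C _) d
  rw [hF, eval_C] at h
  exact_mod_cast h

/-- **A zero-dimensional subscheme of `ℙ^r` not contained in any hyperplane has length `≥ r + 1`**:
`r + 1 ≤ N + dim Ī_1`, where `Ī_1` is the space of linear forms vanishing on `Z`.
[cite: Hartshorne1977, II Ex. 5.10 (p. 125)] [cite: Eisenbud2005, Exercise 2.9 (p. 68)] -/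
theorem succ_le_length_add_finrank_sat_one (hr : 1 ≤ r) {I : Submodule (P k r) (Unit → P k r)}
    (hI : IsGraded (fun _ : Unit => (0 : ℤ)) I) {N : ℕ}
    (hQ : ∀ n : ℤ, ((∑ q ∈ Finset.range (r + 1), (-1 : ℤ) ^ q *
      (Module.finrank k ((quot (fun _ : Unit => (0 : ℤ)) I n).homology q) : ℤ) : ℤ) : ℚ) =
        (C (N : ℚ)).eval (n : ℚ)) :
    r + 1 ≤ N + Module.finrank k (degPiece (fun _ : Unit => (0 : ℤ)) (sat I) 1) := by
  have h := choose_le_length_add_finrank_sat hr hI hQ (d := 1) zero_le_one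
  have h1 : ((1 : ℤ).toNat + r).choose r = r + 1 := by
    rw [Int.toNat_one, add_comm, Nat.choose_succ_self_right]
  omega

end LaurentCech

end Literature.Algebra.Homology

end
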